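import Literature.MathematicalPhysics.QuantumFieldTheory.Balaban1983to89.Beta.DecimatedMomentLimit

/-!
# Beta/DecimatedMomentSummable — the PATTERN slots `w, w' ↗ ℤ^d` of the windowed dressed-moment identities of
`Beta/DecimatedMoment` / `Beta/DecimatedMomentLimit`: all three factors of the two-sided dressed sum infinitely
extended, (L0)/(L1)/(R0) as `HasSum` identities on `ℤ^d`, ONE summability package, and its discharge over `ℝ` from
absolutely summable second moments — in particular from the (5.10)-shape decay of each factor

HONEST FRAMING (cell `pub-balaban`; B12 paper sub-cell, row b2b-balaban-b12-g12, journal claim BETA-b12-O1-PATTERNS).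
The β sub-cell tries to discharge the one-loop input of [Balaban1987RG1] Theorem 2; that would make Bałaban's
ultraviolet STABILITY theorem unconditional in the glossed sense recorded in `Beta/StrangFixAlias` (Gloss 1 / Gloss 2:
NOT «Theorem 2 as printed», never the continuum limit / mass gap / Clay).  This file is far less: it removes the
remaining finiteness idealisation from the kernel-checked bookkeeping identity behind the cell's reading of (1.22) —
the finite supports / windows `Sw`, `Sx` of the two PATTERN factors `w`, `w'` of the dressed sum (the kernel factor `T`
was freed in `Beta/DecimatedMomentLimit`) — and nothing else.  Value = kernel limit-passage leaf, NOT summit progress.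
THIS MODULE DISCHARGES NOTHING of the series; nothing printed in [Balaban1987RG1] is used as a fact.

CONTEXT (internal records, not literature, not used as facts).  `Beta/DecimatedMoment` (an2 lineage) proves, for
FINITE index windows `Sw, ST, Sx ⊂ ℤ^d`, the windowed moment identities of the two-sided dressed sum
`Σ_{u∈Sw} Σ_{t∈ST} Σ_{x∈Sx} (χ(t+x−u) · g u t x) • (w u · T t · w' x)` (`wsum_zero_master`, `wsum_first_master`, the
nine-term `wsum_master_nine`, and `wsum_second_of_vanishing`: with (T0), (T1) the windowed second moment is
`σ · M2_{κλ}(T) · M0(w')`) under the reproduction hypotheses (L0), (L1) on `w` and (R0) on `w'`.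
`Beta/DecimatedMomentLimit` (this row, gen 11) freed the KERNEL slot (`T` infinitely extended, the identity holding
pointwise in the fine variable) and lists under WHAT THIS FILE DOES NOT DO: «The PATTERN slots stay finitely supported …
passing to the limit in those slots needs absolute summability of all three factors and a `tsum` form of (L0)/(L1),
not done here».  The an2 records say the same of the whole moment framework (HOME/BETA/AN2.md §11 (Y17)(d), caveat
(ε): «`LatFun` = FINITELY SUPPORTED kernels — an IDEALISATION … tsum versions of `moment`, `kernelOp`, (L0)/(L1) and of
the windowed identities … routine analysis but NOT done»), and the β lead's status (HOME/BETA-SPEC.md §7.23 (R11-F) v5,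
table (T″)) carries the item «the (O1) PATTERN-SLOT extension (w, w′ infinitely extended with decay; b12 v2, routine,
unclaimed)».  This file does that extension for the IDENTITIES: (L0)/(L1)/(R0) and the zeroth / first / second windowed
moment identities become statements about UNCONDITIONAL sums over `ℤ^d`, resp. `ℤ^d × ℤ^d × ℤ^d` (Mathlib's `HasSum`),
for patterns and kernel that are arbitrary functions `ℤ^d → R`.  It does NOT re-type an2's operator side for
infinitely extended kernels (see DOES NOT DO).

THE OBSERVATION.  an2's finite proof uses finiteness only to write the sums: each of the nine monomial types of the
second-moment weight COLLAPSES ONE index by a reproduction identity at a translated point and then FACTORISES.  With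
unconditional sums the same two moves are (i) `HasSum.prod_fiberwise` — sum the collapsing index first; in the fibre
over `(t, x)` (resp. `(u, t)`) the reproduction hypothesis at `a = t + x` (resp. `a = u − t`) IS the fibre sum — and
(ii) `HasSum.mul` (two unconditionally summable families on `ℤ^d` and `ℤ^d`, product family summable) + uniqueness of
sums in a Hausdorff ring; a monomial whose `T`-moment vanishes has the sum `0` fibrewise, with no hypothesis on the
third factor.  The only price is ONE summability package, `MonoSummable` (§3: the triple families with the nine
product weights of letters `1, y_μ, y_μ y_ν` are summable), which over `ℝ` follows from absolutely summable second
moments `Σ (1 + |y|₁²)|f y| < ∞` of the three factors (§6: the triple family is dominated by a product of three summable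
non-negative families) — in particular from a (5.10)-shape decay hypothesis on each factor.

WHAT IS IN PRINT (context locators only; quotations as already carried verbatim by `Beta/InfiniteVolume`, `B12Beta`,
`B12Sec2to5`, `Beta/DecimatedMomentLimit`).  [Balaban1987RG1] p. 264 [PDF 16], before (1.22): «Now we take a limit of
these functions as T^{(j+1)} ↗ Z^d. This limit exists by the localized representation (1.7).»; (1.22) (typed
`B12Beta.secondMoment`, a `tsum` over `ℤ^d`); p. 292 [PDF 44], (5.1): «Π(b, b′) = lim_{T_1^{(j)} ↗ Z^4} …»; p. 293
[PDF 45], (5.10): «|Π_{μν}(x − y)| ≦ O(1)E₀ exp(−δ₁|x − y|)» (typed `B12Sec2to5.Decay510`).  That the minimisers'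
response patterns / kernels are themselves infinitely extended and exponentially localised is the cell records'
reading (AN2 §11 (Y17) caveat (ε); `Beta/DecimatedMomentLimit` header; their locators B5 (1.63), B11 (190)) — no
quotation is attached here and nothing of it is asserted; the dressed/decimated reading of Π is the cell's typing (D-a)
(AN2 §11), not print's wording.

WHAT THIS FILE PROVES (all [folklore]; `R` any ring; from §2 on a topological ring, Hausdorff where sums are identified;
§6 over `ℝ`):
* §1 `term` (the triple family `(u, (t, x)) ↦ (χ(t+x−u) · g u t x) • (w u · T t · w' x)` on `ℤ^d × ℤ^d × ℤ^d`), `mono`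
  (product weights `p(u)·q(t)·r(x)`), the alphabet `IsMoment₂` (`1`, `y_μ`, `y_μ y_ν`), `term_apply / _add / _sub`,
  `sum_term_eq_wsum` (the finite partial sums over boxes `Sw × ST × Sx` ARE an2's `wsum`), `hasSum_term_of_support` (all
  three factors vanishing off finite windows ⟹ the family has the sum `wsum`: an2's setting is the finitely supported
  case), `hasSum_of_support_eq`;
* §2 the collapse lemmas in `HasSum` form: `hasSum_fibre_left` / `hasSum_term_left` / `hasSum_term_left_of_zero` (LEFT
  index `u` collapsed by `∀ a, HasSum (u ↦ (χ(a−u) · p u) • w u) ρ` — (L0∞): `p = 1, ρ = σ`; (L1∞)_κ: `p = u_κ, ρ = C κ` —: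
  the `mono p q r` family has the sum `ρ · m_q · m_r`, and the sum `0` as soon as the `q • T` family sums to `0`, with NO
  hypothesis on `w'`), `hasSum_fibre_right` / `hasSum_term_right` / `hasSum_term_right_of_zero` (RIGHT index `x`
  collapsed by (R0∞) `∀ a, HasSum (x ↦ χ(x−a) • w' x) σ'`), `hasSum_one_smul`, `hasSum_window_one`;
* §3 `MonoSummable` and the identities with ALL THREE factors infinitely extended: `hasSum_term_zero` (`σ · m₀ · n₀`),
  `hasSum_term_first` (`σ·m₁·n₀ + σ·m₀·n₁ − C_κ·m₀·n₀`), `second_weight_expand`, `hasSum_term_second` (THE NINE-TERM MASTER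
  IDENTITY as a `HasSum` statement: an2's right member with every finite moment replaced by the infinite one),
  `hasSum_term_second_of_vanishing` / `tsum_term_second_of_vanishing` (infinite (T0), (T1) ⟹ `σ · m₂ · n₀`, needing of
  `w'` only (R0∞) and its sum `n₀`), `summable_term_second`;
* §4 `ConstReproSum` / `LinReproSum` ((L0∞) / (L1∞) through the window `N•ℤ^d` for patterns that are FUNCTIONS on `ℤ^d`),
  `constReproSum_iff_right` ((R0∞) = `ConstReproSum` of `w'`, the window being even), the bridges
  `constReproSum_of_constRepro` / `linReproSum_of_linRepro` / `constRepro_of_constReproSum` / `linRepro_of_linReproSum`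
  (an2's `Finsupp` hypotheses `DecimatedMoment.ConstRepro` / `LinRepro` are EXACTLY the finitely supported case),
  `decimatedSum_second_moment_hasSum` / `_tsum` (the identity `σ · m₂ · n₀` in that form), and CONSISTENCY with gen 11:
  `hasSum_slice_of_hasSum_term` (for `Finsupp` patterns a sum of the triple family is a sum of
  `DecimatedMomentLimit.slice`, fibres over the fine point);
* §5 `dressedSum` (`K(y) = Σ'_{(u,x)} w u · T(y+u−x) · w' x`, the dressed kernel at the coarse output point, both patterns
  infinite), `coarseEquiv` (`(u,(t,x)) ↦ (t+x−u,(u,x))`), `term_comp_coarseEquiv_symm`, `hasSum_coarse` (REGROUPING by the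
  coarse point under fibrewise summability of `K`: `Σ_y (χ y · φ y) • K y` has the same sum), then
  `decimatedSum_second_moment_hasSum_coarse` (`Σ_y (cosetInd N y · y_κ y_λ) • K y = σ · m₂ · n₀`) and
  `decimatedSum_second_moment_hasSum_lattice` (read on the coarse lattice `y = N • z`, `N ≠ 0`, via gen 11's
  `hasSum_decimate_iff`: weight `N² · z_κ z_λ`);
* §6 over `ℝ`: `AbsMoment₂` (`Σ_y (1 + |y|₁²) · |f y| < ∞`), `abs_le_of_isMoment₂`, the ENGINE `summable_term_of_bound`
  (window bounded by `1`, weight of at most quadratic growth in each variable separately, three `AbsMoment₂` factors ⟹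
  the triple family is summable; `Summable.mul_of_nonneg` twice + `Summable.of_norm_bounded`),
  `monoSummable_of_absMoment₂`, `summable_window_smul_of_absMoment₂` / `summable_smul_of_absMoment₂` /
  `summable_of_absMoment₂`, `summable_dressed_fibre` (the fibres of `K` are summable), `absMoment₂_of_decay510` (from gen
  11's `summable_weight_mul_of_decay510`), `hasSum_window_of_tsum_eq`, `constReproSum_of_tsum` / `linReproSum_of_tsum`
  ((L0∞)/(L1∞) from the `tsum` identities), and the finals `decimatedSum_second_moment_of_absMoment₂` (fine-point ∧
  coarse-point form; hypotheses: three `AbsMoment₂`, the `tsum` identities (L0)/(L1) for `w`, (R0) for `w'`, (T0)/(T1)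
  for `T`; value `σ · (Σ'_t T t · t_κ · t_λ) · Σ' w'`), `…_lattice` (coarse lattice, `N ≠ 0`),
  `decimatedSum_second_moment_of_decay510` ((5.10)-shape decay of all three factors, each with its own constants),
  `decimatedSum_second_moment_eq_secondMoment` (for a component kernel `T = P μ ν` of a `B12Beta.Kernel`:
  `Σ'_y (cosetInd N y · y_μ y_ν) • dressedSum w (P μ ν) w' y = σ · B12Beta.secondMoment P μ ν · Σ' w'` — the typed right
  member of (1.22) times the two pattern masses), `absMoment₂_of_finsupp` (the `Finsupp` case is contained).

WHAT THIS FILE DOES NOT DO.  Nothing about the operators' thermodynamic limit ((O1′): AN2 §11 (Y13), lit3's located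
print audit C-lit3g10-1); no `tsum` / ℓ¹ re-typing of an2's OPERATOR side for infinitely extended kernels —
`KernelRepresentation.kernelOp`, the (H-aff) ⟹ (L0)/(L1) bridge (`constRepro_of_reproduces` / `linRepro_of_reproduces`),
`AffineReproduction.hAff_of_spec` —: the present (L0∞)/(L1∞)/(R0∞) are HYPOTHESES, typed so that such a bridge can target
them; nothing about (H-aff)_k, (Q-aff), (I4′), (I2)/(I4)/(I5)/(I6); no identification of `w, T, w'` with Bałaban's
patterns / kernel, and no claim that his objects have absolutely summable second moments beyond what a (5.10)-shape
decay HYPOTHESIS gives through `absMoment₂_of_decay510`; only unconditional summation (no iterated or conditional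
limits, no rates, no error terms).  Labels: [folklore] = elementary algebra / elementary topology of infinite sums,
proved here in full; no cited facts are used.

Version v1 (2026-08-19, b2b-balaban-b12-g12).  value = kernel limit-passage leaf, NOT summit progress.
-/

namespace Literature.MathematicalPhysics.QuantumFieldTheory.Balaban1983to89.Beta.DecimatedMomentSummable

open Finset Filter Topology
open DecimatedMoment DecimatedMomentLimit

variable {d : ℕ} {R : Type*} [Ring R]

/-! ## §1 The triple family on `ℤ^d × ℤ^d × ℤ^d`, monomial weights, finite consistency -/

/-- The summand of the windowed two-sided dressed sum of `Beta/DecimatedMoment` as ONE family on the triple index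
`q = (u, (t, x))`: `term χ w T w' g (u, (t, x)) = (χ(t+x−u) · g u t x) • (w u · T t · w' x)`. [folklore] -/
def term (χ : (Fin d → ℤ) → ℤ) (w T w' : (Fin d → ℤ) → R)
    (g : (Fin d → ℤ) → (Fin d → ℤ) → (Fin d → ℤ) → ℤ) (q : (Fin d → ℤ) × (Fin d → ℤ) × (Fin d → ℤ)) : R :=
  (χ (q.2.1 + q.2.2 - q.1) * g q.1 q.2.1 q.2.2) • (w q.1 * T q.2.1 * w' q.2.2)

/-- Product («monomial») weights `mono p q r u t x = p u · (q t · r x)`. [folklore] -/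
def mono (p q r : (Fin d → ℤ) → ℤ) : (Fin d → ℤ) → (Fin d → ℤ) → (Fin d → ℤ) → ℤ :=
  fun u t x => p u * (q t * r x)

/-- The alphabet of integer weights of degree `≤ 2` in one lattice variable: `1`, `y_μ`, `y_μ y_ν` — the weights of
the moments `M0`, `M1`, `M2`. [folklore] -/
inductive IsMoment₂ : ((Fin d → ℤ) → ℤ) → Prop
  | one : IsMoment₂ (fun _ => 1)
  | coord (μ : Fin d) : IsMoment₂ (fun y => y μ)
  | coord2 (μ ν : Fin d) : IsMoment₂ (fun y => y μ * y ν)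

section Algebra

variable (χ : (Fin d → ℤ) → ℤ) (w T w' : (Fin d → ℤ) → R)

/-- Unfolding at a triple. [folklore] -/
theorem term_apply (g : (Fin d → ℤ) → (Fin d → ℤ) → (Fin d → ℤ) → ℤ) (u t x : Fin d → ℤ) :
    term χ w T w' g (u, t, x) = (χ (t + x - u) * g u t x) • (w u * T t * w' x) := rfl

/-- `term` is additive in the integer weight. [folklore] -/
theorem term_add (g h : (Fin d → ℤ) → (Fin d → ℤ) → (Fin d → ℤ) → ℤ) :
    term χ w T w' (g + h) = term χ w T w' g + term χ w T w' h := by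
  funext q
  simp only [term, Pi.add_apply, mul_add, add_smul]

/-- `term` is subtractive in the integer weight. [folklore] -/
theorem term_sub (g h : (Fin d → ℤ) → (Fin d → ℤ) → (Fin d → ℤ) → ℤ) :
    term χ w T w' (g - h) = term χ w T w' g - term χ w T w' h := by
  funext q
  simp only [term, Pi.sub_apply, mul_sub, sub_smul]

/-- CONSISTENCY WITH THE FINITE OBJECT: over a product of finite windows the triple family sums to an2's
`DecimatedMoment.wsum`. [folklore] -/
theorem sum_term_eq_wsum (Sw ST Sx : Finset (Fin d → ℤ)) (g : (Fin d → ℤ) → (Fin d → ℤ) → (Fin d → ℤ) → ℤ) :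
    ∑ q ∈ Sw ×ˢ (ST ×ˢ Sx), term χ w T w' g q = wsum χ Sw ST Sx w T w' g := by
  rw [Finset.sum_product]
  unfold wsum
  refine Finset.sum_congr rfl (fun u _ => ?_)
  rw [Finset.sum_product]
  rfl

end Algebra

section FiniteSupport

variable [TopologicalSpace R] (χ : (Fin d → ℤ) → ℤ) (w T w' : (Fin d → ℤ) → R)

/-- For factors vanishing off finite windows `Sw, ST, Sx` the triple family is finitely supported and HAS the sum
`wsum χ Sw ST Sx w T w' g` (any topology): every statement below restricts to an2's finite ones. [folklore] -/
theorem hasSum_term_of_support (Sw ST Sx : Finset (Fin d → ℤ)) (hw : ∀ u ∉ Sw, w u = 0)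
    (hT : ∀ t ∉ ST, T t = 0) (hw' : ∀ x ∉ Sx, w' x = 0)
    (g : (Fin d → ℤ) → (Fin d → ℤ) → (Fin d → ℤ) → ℤ) :
    HasSum (term χ w T w' g) (wsum χ Sw ST Sx w T w' g) := by
  rw [← sum_term_eq_wsum]
  refine hasSum_sum_of_ne_finset_zero (fun q hq => ?_)
  obtain ⟨u, t, x⟩ := q
  simp only [Finset.mem_product, not_and_or] at hq
  show (χ (t + x - u) * g u t x) • (w u * T t * w' x) = 0
  rcases hq with hu | ht | hx
  · rw [hw u hu, zero_mul, zero_mul, smul_zero]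
  · rw [hT t ht, mul_zero, zero_mul, smul_zero]
  · rw [hw' x hx, mul_zero, smul_zero]

/-- A finite windowed-moment identity (the shape of (L0), (L1), (R0) in `Beta/DecimatedMoment`) for a pattern
vanishing off its window IS the corresponding `HasSum` statement over all of `ℤ^d`. [folklore] -/
theorem hasSum_of_support_eq (S : Finset (Fin d → ℤ)) (f : (Fin d → ℤ) → R) (hf : ∀ u ∉ S, f u = 0)
    (a : (Fin d → ℤ) → ℤ) {c : R} (h : ∑ u ∈ S, a u • f u = c) : HasSum (fun u => a u • f u) c := by
  rw [← h]
  exact hasSum_sum_of_ne_finset_zero (fun u hu => by rw [hf u hu, smul_zero])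

end FiniteSupport

/-! ## §2 Collapsing one index under an INFINITE reproduction hypothesis: the three monomial types -/

section Collapse

variable [TopologicalSpace R] [IsTopologicalRing R] [T2Space R]
variable (χ : (Fin d → ℤ) → ℤ) (w T w' : (Fin d → ℤ) → R)

omit [IsTopologicalRing R] [T2Space R] in
/-- `HasSum f m` as the `1 •`-weighted statement. [folklore] -/
theorem hasSum_one_smul {f : (Fin d → ℤ) → R} {m : R} (h : HasSum f m) :
    HasSum (fun y => (1 : ℤ) • f y) m := by
  simpa only [one_smul] using h

omit [IsTopologicalRing R] [T2Space R] in
/-- (L0∞) in the `χ · 1`-weighted shape used by the left collapse. [folklore] -/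
theorem hasSum_window_one {σ : R} (hL0 : ∀ a, HasSum (fun u => χ (a - u) • w u) σ) (a : Fin d → ℤ) :
    HasSum (fun u => (χ (a - u) * (fun _ => (1 : ℤ)) u) • w u) σ := by
  simpa only [mul_one] using hL0 a

omit [T2Space R] in
/-- **LEFT COLLAPSE** (fibres over `(t, x)`, inner index `u`).  Weight `pw u · (q t · r x)`; hypothesis: for every
`a` the window family `u ↦ (χ(a−u) · pw u) • w u` has the sum `ρ` ((L0∞): `pw = 1, ρ = σ`; (L1∞)_κ: `pw = u_κ,
ρ = C κ`).  If the triple family is summable, the FACTORISED fibre-sum family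
`(t, x) ↦ (q t • (ρ · T t)) · (r x • w' x)` has the sum `Σ' term` (the inner sum is the hypothesis at `a = t + x`,
POINTWISE; `HasSum.prod_fiberwise`). [folklore] -/
theorem hasSum_fibre_left {ρ : R} (pw : (Fin d → ℤ) → ℤ)
    (hL : ∀ a, HasSum (fun u => (χ (a - u) * pw u) • w u) ρ) (q r : (Fin d → ℤ) → ℤ)
    (hS : Summable (term χ w T w' (mono pw q r))) :
    HasSum (fun p : (Fin d → ℤ) × (Fin d → ℤ) => (q p.1 • (ρ * T p.1)) * (r p.2 • w' p.2))
      (∑' s, term χ w T w' (mono pw q r) s) := by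
  set f := term χ w T w' (mono pw q r) with hf
  have hF : HasSum (f ∘ ⇑(Equiv.prodComm ((Fin d → ℤ) × (Fin d → ℤ)) (Fin d → ℤ))) (∑' s, f s) :=
    (Equiv.hasSum_iff _).mpr hS.hasSum
  have hfib : ∀ p : (Fin d → ℤ) × (Fin d → ℤ),
      HasSum (fun u => (f ∘ ⇑(Equiv.prodComm ((Fin d → ℤ) × (Fin d → ℤ)) (Fin d → ℤ))) (p, u))
        ((q p.1 * r p.2) • (ρ * T p.1 * w' p.2)) := by
    intro p
    have h := (((hL (p.1 + p.2)).mul_right (T p.1)).mul_right (w' p.2)).const_smul (q p.1 * r p.2)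
    refine h.congr_fun (fun u => ?_)
    simp only [Function.comp_apply, Equiv.prodComm_apply, Prod.swap_prod_mk, hf, term, mono, ← mul_assoc]
    rw [mul_assoc (χ _ * pw u) (q _) (r _)]
    exact smul_pull_left _ _ _ _ _
  have hG := hF.prod_fiberwise hfib
  refine hG.congr_fun (fun p => ?_)
  rw [smul_mul_smul_comm, mul_assoc]

/-- Left collapse with both moments present: the triple family has the sum `ρ · mq · mr` (`HasSum.mul` on the
factorised fibre-sum family + uniqueness of limits). [folklore] -/
theorem hasSum_term_left {ρ : R} (pw : (Fin d → ℤ) → ℤ)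
    (hL : ∀ a, HasSum (fun u => (χ (a - u) * pw u) • w u) ρ) (q r : (Fin d → ℤ) → ℤ) {mq mr : R}
    (hq : HasSum (fun t => q t • T t) mq) (hr : HasSum (fun x => r x • w' x) mr)
    (hS : Summable (term χ w T w' (mono pw q r))) :
    HasSum (term χ w T w' (mono pw q r)) (ρ * mq * mr) := by
  have hG := hasSum_fibre_left χ w T w' pw hL q r hS
  have hA : HasSum (fun t => q t • (ρ * T t)) (ρ * mq) := by
    simpa only [mul_smul_comm] using hq.mul_left ρ
  -- (`HasSum.mul` must be elaborated WITHOUT an expected type: the family `fun x => f x.1 * g x.2` is not a pattern)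
  have hP := hA.mul hr hG.summable
  exact hG.unique hP ▸ hS.hasSum

/-- Left collapse when the `T`-moment VANISHES (`Σ q • T = 0`): the triple family has the sum `0`, and NO
hypothesis on the `w'`-family is needed (fibre the factorised family once more, over `x`). [folklore] -/
theorem hasSum_term_left_of_zero {ρ : R} (pw : (Fin d → ℤ) → ℤ)
    (hL : ∀ a, HasSum (fun u => (χ (a - u) * pw u) • w u) ρ) (q r : (Fin d → ℤ) → ℤ)
    (hq : HasSum (fun t => q t • T t) 0) (hS : Summable (term χ w T w' (mono pw q r))) :
    HasSum (term χ w T w' (mono pw q r)) 0 := by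
  have hG := hasSum_fibre_left χ w T w' pw hL q r hS
  have hA : HasSum (fun t => q t • (ρ * T t)) 0 := by
    simpa only [mul_smul_comm, mul_zero] using hq.mul_left ρ
  have hG' := (Equiv.hasSum_iff (Equiv.prodComm (Fin d → ℤ) (Fin d → ℤ))).mpr hG
  have hfib : ∀ x : Fin d → ℤ, HasSum (fun t =>
      ((fun p : (Fin d → ℤ) × (Fin d → ℤ) => (q p.1 • (ρ * T p.1)) * (r p.2 • w' p.2))
        ∘ ⇑(Equiv.prodComm (Fin d → ℤ) (Fin d → ℤ))) (x, t)) 0 := by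
    intro x
    simpa only [Function.comp_apply, Equiv.prodComm_apply, Prod.swap_prod_mk, zero_mul]
      using hA.mul_right (r x • w' x)
  have h0 : HasSum (fun _ : Fin d → ℤ => (0 : R)) (∑' s, term χ w T w' (mono pw q r) s) :=
    hG'.prod_fiberwise hfib
  exact h0.unique hasSum_zero ▸ hS.hasSum

omit [T2Space R] in
/-- **RIGHT COLLAPSE** (fibres over `(u, t)`, inner index `x`).  Weight `p u · (q t · 1)`; hypothesis (R0∞): for
every `a` the family `x ↦ χ(x−a) • w' x` has the sum `σ'`.  The factorised fibre-sum family
`(u, t) ↦ (p u • w u) · (q t • (T t · σ'))` has the sum `Σ' term` (inner sum = (R0∞) at `a = u − t`). [folklore] -/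
theorem hasSum_fibre_right {σ' : R} (hR0 : ∀ a, HasSum (fun x => χ (x - a) • w' x) σ')
    (p q : (Fin d → ℤ) → ℤ) (hS : Summable (term χ w T w' (mono p q (fun _ => 1)))) :
    HasSum (fun m : (Fin d → ℤ) × (Fin d → ℤ) => (p m.1 • w m.1) * (q m.2 • (T m.2 * σ')))
      (∑' s, term χ w T w' (mono p q (fun _ => 1)) s) := by
  set f := term χ w T w' (mono p q (fun _ => 1)) with hf
  have hF : HasSum (f ∘ ⇑(Equiv.prodAssoc (Fin d → ℤ) (Fin d → ℤ) (Fin d → ℤ))) (∑' s, f s) :=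
    (Equiv.hasSum_iff _).mpr hS.hasSum
  have hfib : ∀ m : (Fin d → ℤ) × (Fin d → ℤ),
      HasSum (fun x => (f ∘ ⇑(Equiv.prodAssoc (Fin d → ℤ) (Fin d → ℤ) (Fin d → ℤ))) (m, x))
        ((p m.1 * q m.2) • (w m.1 * T m.2 * σ')) := by
    intro m
    have h := ((hR0 (m.1 - m.2)).mul_left (w m.1 * T m.2)).const_smul (p m.1 * q m.2)
    refine h.congr_fun (fun x => ?_)
    simp only [Function.comp_apply, Equiv.prodAssoc_apply, hf, term, mono, mul_one]
    rw [show m.2 + x - m.1 = x - (m.1 - m.2) by abel]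
    exact smul_pull_right _ _ _ _ _
  have hG := hF.prod_fiberwise hfib
  refine hG.congr_fun (fun m => ?_)
  rw [smul_mul_smul_comm, mul_assoc]

/-- Right collapse with both moments present: the triple family has the sum `mp · mq · σ'`. [folklore] -/
theorem hasSum_term_right {σ' : R} (hR0 : ∀ a, HasSum (fun x => χ (x - a) • w' x) σ')
    (p q : (Fin d → ℤ) → ℤ) {mp mq : R} (hp : HasSum (fun u => p u • w u) mp)
    (hq : HasSum (fun t => q t • T t) mq) (hS : Summable (term χ w T w' (mono p q (fun _ => 1)))) :
    HasSum (term χ w T w' (mono p q (fun _ => 1))) (mp * mq * σ') := by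
  have hG := hasSum_fibre_right χ w T w' hR0 p q hS
  have hB : HasSum (fun t => q t • (T t * σ')) (mq * σ') := by
    simpa only [smul_mul_assoc] using hq.mul_right σ'
  have hP := hp.mul hB hG.summable
  rw [mul_assoc]
  exact hG.unique hP ▸ hS.hasSum

/-- Right collapse when the `T`-moment vanishes: sum `0`, no hypothesis on the `w`-family. [folklore] -/
theorem hasSum_term_right_of_zero {σ' : R} (hR0 : ∀ a, HasSum (fun x => χ (x - a) • w' x) σ')
    (p q : (Fin d → ℤ) → ℤ) (hq : HasSum (fun t => q t • T t) 0)
    (hS : Summable (term χ w T w' (mono p q (fun _ => 1)))) :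
    HasSum (term χ w T w' (mono p q (fun _ => 1))) 0 := by
  have hG := hasSum_fibre_right χ w T w' hR0 p q hS
  have hB : HasSum (fun t => q t • (T t * σ')) 0 := by
    simpa only [smul_mul_assoc, zero_mul] using hq.mul_right σ'
  have hfib : ∀ u : Fin d → ℤ, HasSum (fun t => (p u • w u) * (q t • (T t * σ'))) 0 := by
    intro u
    simpa only [mul_zero] using hB.mul_left (p u • w u)
  have h0 : HasSum (fun _ : Fin d → ℤ => (0 : R)) (∑' s, term χ w T w' (mono p q (fun _ => 1)) s) :=
    hG.prod_fiberwise hfib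
  exact h0.unique hasSum_zero ▸ hS.hasSum

end Collapse

/-! ## §3 The windowed moment identities with ALL THREE factors infinitely extended -/

section Master

variable [TopologicalSpace R]

/-- Summability of the triple family for every product weight of letters of the alphabet `IsMoment₂` (degree `≤ 2`
in each of `u, t, x`).  The identities below consume 1, 3, resp. 9 of these families; over `ℝ` all of them follow
from absolutely summable second moments of `w, T, w'` (§6, `monoSummable_of_absMoment₂`). [folklore] -/
def MonoSummable (χ : (Fin d → ℤ) → ℤ) (w T w' : (Fin d → ℤ) → R) : Prop :=
  ∀ p q r, IsMoment₂ p → IsMoment₂ q → IsMoment₂ r → Summable (term χ w T w' (mono p q r))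

variable [IsTopologicalRing R] [T2Space R]
variable (χ : (Fin d → ℤ) → ℤ) (w T w' : (Fin d → ℤ) → R)

/-- **Windowed ZEROTH moment**, infinite patterns and kernel ((L0∞) only): if `Σ T = m₀`, `Σ w' = n₀` and the
triple family is summable, `Σ_{u,t,x} χ(t+x−u) • (w u · T t · w' x) = σ · m₀ · n₀`. [folklore] -/
theorem hasSum_term_zero {σ : R} (hL0 : ∀ a, HasSum (fun u => χ (a - u) • w u) σ) {m₀ n₀ : R}
    (h0 : HasSum T m₀) (hn0 : HasSum w' n₀) (hS : Summable (term χ w T w' (fun _ _ _ => 1))) :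
    HasSum (term χ w T w' (fun _ _ _ => 1)) (σ * m₀ * n₀) := by
  have e : (fun _ _ _ => (1 : ℤ) : (Fin d → ℤ) → (Fin d → ℤ) → (Fin d → ℤ) → ℤ)
      = mono (fun _ => 1) (fun _ => 1) (fun _ => 1) := by
    funext u t x
    simp only [mono, mul_one]
  rw [e] at hS ⊢
  exact hasSum_term_left χ w T w' _ (hasSum_window_one χ w hL0) _ _ (hasSum_one_smul h0)
    (hasSum_one_smul hn0) hS

/-- **Windowed FIRST moment** ((L0∞), (L1∞)): with `Σ T = m₀`, `Σ t_κ • T = m₁`, `Σ w' = n₀`, `Σ x_κ • w' = n₁`,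
`Σ_{u,t,x} (χ(t+x−u) · (t+x−u)_κ) • (w u · T t · w' x) = σ·m₁·n₀ + σ·m₀·n₁ − C_κ·m₀·n₀`. [folklore] -/
theorem hasSum_term_first {σ : R} {C : Fin d → R} (hL0 : ∀ a, HasSum (fun u => χ (a - u) • w u) σ)
    (hL1 : ∀ a κ, HasSum (fun u => (χ (a - u) * u κ) • w u) (C κ)) (κ : Fin d) {m₀ m₁ n₀ n₁ : R}
    (h0 : HasSum T m₀) (h1 : HasSum (fun t => t κ • T t) m₁) (hn0 : HasSum w' n₀)
    (hn1 : HasSum (fun x => x κ • w' x) n₁) (hS : MonoSummable χ w T w') :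
    HasSum (term χ w T w' (fun u t x => (t + x - u) κ)) (σ * m₁ * n₀ + σ * m₀ * n₁ - C κ * m₀ * n₀) := by
  have expand : (fun u t x : Fin d → ℤ => (t + x - u) κ)
      = mono (fun _ => 1) (fun t => t κ) (fun _ => 1) + mono (fun _ => 1) (fun _ => 1) (fun x => x κ)
        - mono (fun u => u κ) (fun _ => 1) (fun _ => 1) := by
    funext u t x
    simp only [Pi.add_apply, Pi.sub_apply, mono]
    ring
  rw [expand, term_sub, term_add]
  simp only [Pi.add_def, Pi.sub_def]
  exact ((hasSum_term_left χ w T w' _ (hasSum_window_one χ w hL0) _ _ h1 (hasSum_one_smul hn0)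
      (hS _ _ _ .one (.coord κ) .one)).add
    (hasSum_term_left χ w T w' _ (hasSum_window_one χ w hL0) _ _ (hasSum_one_smul h0) hn1
      (hS _ _ _ .one .one (.coord κ)))).sub
    (hasSum_term_left χ w T w' _ (fun a => hL1 a κ) _ _ (hasSum_one_smul h0) (hasSum_one_smul hn0)
      (hS _ _ _ (.coord κ) .one .one))

/-- The nine-monomial expansion of the second-moment weight. [folklore] -/
theorem second_weight_expand (κ l : Fin d) :
    (fun u t x : Fin d → ℤ => (t + x - u) κ * (t + x - u) l)
      = mono (fun _ => 1) (fun t => t κ * t l) (fun _ => 1)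
        + mono (fun _ => 1) (fun t => t κ) (fun x => x l)
        + mono (fun _ => 1) (fun t => t l) (fun x => x κ)
        - mono (fun u => u l) (fun t => t κ) (fun _ => 1)
        - mono (fun u => u κ) (fun t => t l) (fun _ => 1)
        + mono (fun _ => 1) (fun _ => 1) (fun x => x κ * x l)
        - mono (fun u => u l) (fun _ => 1) (fun x => x κ)
        - mono (fun u => u κ) (fun _ => 1) (fun x => x l)
        + mono (fun u => u κ * u l) (fun _ => 1) (fun _ => 1) := by
  funext u t x
  simp only [Pi.add_apply, Pi.sub_apply, mono]
  ring

/-- **Windowed SECOND moment — the nine-term MASTER IDENTITY with all three factors infinitely extended**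
((L0∞), (L1∞), (R0∞); NO vanishing hypothesis on `T`): with the `T`-moments `m₀, m₁κ, m₁λ, m₂`, the
`w'`-moments `n₀, n₁κ, n₁λ, n₂` and the `w`-moment `p₂ = Σ (u_κ u_λ) • w u` (all as `HasSum`, unconditional
summation on `ℤ^d`) and `MonoSummable`, the family `(χ(t+x−u) · (t+x−u)_κ (t+x−u)_λ) • (w u · T t · w' x)` on
`ℤ^d × ℤ^d × ℤ^d` has the sum given by an2's nine-term right member (`DecimatedMoment.wsum_master_nine`) with every
finite moment replaced by the corresponding infinite one. [folklore] -/
theorem hasSum_term_second {σ σ' : R} {C : Fin d → R} (hL0 : ∀ a, HasSum (fun u => χ (a - u) • w u) σ)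
    (hL1 : ∀ a κ, HasSum (fun u => (χ (a - u) * u κ) • w u) (C κ))
    (hR0 : ∀ a, HasSum (fun x => χ (x - a) • w' x) σ') (κ l : Fin d)
    {m₀ m₁κ m₁l m₂ n₀ n₁κ n₁l n₂ p₂ : R}
    (h0 : HasSum T m₀) (h1κ : HasSum (fun t => t κ • T t) m₁κ) (h1l : HasSum (fun t => t l • T t) m₁l)
    (h2 : HasSum (fun t => (t κ * t l) • T t) m₂) (hn0 : HasSum w' n₀)
    (hn1κ : HasSum (fun x => x κ • w' x) n₁κ) (hn1l : HasSum (fun x => x l • w' x) n₁l)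
    (hn2 : HasSum (fun x => (x κ * x l) • w' x) n₂) (hp2 : HasSum (fun u => (u κ * u l) • w u) p₂)
    (hS : MonoSummable χ w T w') :
    HasSum (term χ w T w' (fun u t x => (t + x - u) κ * (t + x - u) l))
      (σ * m₂ * n₀ + σ * m₁κ * n₁l + σ * m₁l * n₁κ - C l * m₁κ * n₀ - C κ * m₁l * n₀
        + σ * m₀ * n₂ - C l * m₀ * n₁κ - C κ * m₀ * n₁l + p₂ * m₀ * σ') := by
  have hW := hasSum_window_one χ w hL0
  rw [second_weight_expand, term_add, term_sub, term_sub, term_add, term_sub, term_sub, term_add, term_add]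
  simp only [Pi.add_def, Pi.sub_def]
  exact ((((((((hasSum_term_left χ w T w' _ hW _ _ h2 (hasSum_one_smul hn0)
      (hS _ _ _ .one (.coord2 κ l) .one)).add
    (hasSum_term_left χ w T w' _ hW _ _ h1κ hn1l (hS _ _ _ .one (.coord κ) (.coord l)))).add
    (hasSum_term_left χ w T w' _ hW _ _ h1l hn1κ (hS _ _ _ .one (.coord l) (.coord κ)))).sub
    (hasSum_term_left χ w T w' _ (fun a => hL1 a l) _ _ h1κ (hasSum_one_smul hn0)
      (hS _ _ _ (.coord l) (.coord κ) .one))).sub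
    (hasSum_term_left χ w T w' _ (fun a => hL1 a κ) _ _ h1l (hasSum_one_smul hn0)
      (hS _ _ _ (.coord κ) (.coord l) .one))).add
    (hasSum_term_left χ w T w' _ hW _ _ (hasSum_one_smul h0) hn2 (hS _ _ _ .one .one (.coord2 κ l)))).sub
    (hasSum_term_left χ w T w' _ (fun a => hL1 a l) _ _ (hasSum_one_smul h0) hn1κ
      (hS _ _ _ (.coord l) .one (.coord κ)))).sub
    (hasSum_term_left χ w T w' _ (fun a => hL1 a κ) _ _ (hasSum_one_smul h0) hn1l
      (hS _ _ _ (.coord κ) .one (.coord l)))).add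
    (hasSum_term_right χ w T w' hR0 _ _ hp2 (hasSum_one_smul h0) (hS _ _ _ (.coord2 κ l) .one .one))

/-- **THE IDENTITY under the infinite (T0), (T1)** — `Σ T = 0`, `Σ t_κ • T = 0 = Σ t_λ • T`, `Σ (t_κ t_λ) • T = m₂`:
the windowed second moment of the two-sided dressed sum, all three factors infinitely extended, is `σ · m₂ · n₀`
(`n₀ = Σ w'`).  Eight of the nine monomial families have the sum `0` FIBREWISE, so no first or second moment of
`w` or `w'` is needed — only `MonoSummable`. [folklore] -/
theorem hasSum_term_second_of_vanishing {σ σ' : R} {C : Fin d → R}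
    (hL0 : ∀ a, HasSum (fun u => χ (a - u) • w u) σ)
    (hL1 : ∀ a κ, HasSum (fun u => (χ (a - u) * u κ) • w u) (C κ))
    (hR0 : ∀ a, HasSum (fun x => χ (x - a) • w' x) σ') (κ l : Fin d) {m₂ n₀ : R}
    (hT0 : HasSum T 0) (hT1κ : HasSum (fun t => t κ • T t) 0) (hT1l : HasSum (fun t => t l • T t) 0)
    (h2 : HasSum (fun t => (t κ * t l) • T t) m₂) (hn0 : HasSum w' n₀) (hS : MonoSummable χ w T w') :
    HasSum (term χ w T w' (fun u t x => (t + x - u) κ * (t + x - u) l)) (σ * m₂ * n₀) := by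
  have hW := hasSum_window_one χ w hL0
  have h0' : HasSum (fun t => (fun _ => (1 : ℤ)) t • T t) 0 := hasSum_one_smul hT0
  rw [second_weight_expand, term_add, term_sub, term_sub, term_add, term_sub, term_sub, term_add, term_add]
  simp only [Pi.add_def, Pi.sub_def]
  have h := ((((((((hasSum_term_left χ w T w' _ hW _ _ h2 (hasSum_one_smul hn0)
      (hS _ _ _ .one (.coord2 κ l) .one)).add
    (hasSum_term_left_of_zero χ w T w' _ hW _ (fun x => x l) hT1κ (hS _ _ _ .one (.coord κ) (.coord l)))).add
    (hasSum_term_left_of_zero χ w T w' _ hW _ (fun x => x κ) hT1l (hS _ _ _ .one (.coord l) (.coord κ)))).sub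
    (hasSum_term_left_of_zero χ w T w' _ (fun a => hL1 a l) _ (fun _ => 1) hT1κ
      (hS _ _ _ (.coord l) (.coord κ) .one))).sub
    (hasSum_term_left_of_zero χ w T w' _ (fun a => hL1 a κ) _ (fun _ => 1) hT1l
      (hS _ _ _ (.coord κ) (.coord l) .one))).add
    (hasSum_term_left_of_zero χ w T w' _ hW _ (fun x => x κ * x l) h0' (hS _ _ _ .one .one (.coord2 κ l)))).sub
    (hasSum_term_left_of_zero χ w T w' _ (fun a => hL1 a l) _ (fun x => x κ) h0'
      (hS _ _ _ (.coord l) .one (.coord κ)))).sub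
    (hasSum_term_left_of_zero χ w T w' _ (fun a => hL1 a κ) _ (fun x => x l) h0'
      (hS _ _ _ (.coord κ) .one (.coord l)))).add
    (hasSum_term_right_of_zero χ w T w' hR0 (fun u => u κ * u l) _ h0' (hS _ _ _ (.coord2 κ l) .one .one))
  simpa only [add_zero, sub_zero] using h

omit [T2Space R] in
/-- The second-moment triple family is summable as soon as `MonoSummable` holds (it is a signed sum of nine
monomial families). [folklore] -/
theorem summable_term_second (κ l : Fin d) (hS : MonoSummable χ w T w') :
    Summable (term χ w T w' (fun u t x => (t + x - u) κ * (t + x - u) l)) := by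
  rw [second_weight_expand, term_add, term_sub, term_sub, term_add, term_sub, term_sub, term_add, term_add]
  exact ((((((((hS _ _ _ .one (.coord2 κ l) .one).add (hS _ _ _ .one (.coord κ) (.coord l))).add
    (hS _ _ _ .one (.coord l) (.coord κ))).sub (hS _ _ _ (.coord l) (.coord κ) .one)).sub
    (hS _ _ _ (.coord κ) (.coord l) .one)).add (hS _ _ _ .one .one (.coord2 κ l))).sub
    (hS _ _ _ (.coord l) .one (.coord κ))).sub (hS _ _ _ (.coord κ) .one (.coord l))).add
    (hS _ _ _ (.coord2 κ l) .one .one)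

/-- `tsum` form of the vanishing case. [folklore] -/
theorem tsum_term_second_of_vanishing {σ σ' : R} {C : Fin d → R}
    (hL0 : ∀ a, HasSum (fun u => χ (a - u) • w u) σ)
    (hL1 : ∀ a κ, HasSum (fun u => (χ (a - u) * u κ) • w u) (C κ))
    (hR0 : ∀ a, HasSum (fun x => χ (x - a) • w' x) σ') (κ l : Fin d)
    (hT0 : HasSum T 0) (hT1κ : HasSum (fun t => t κ • T t) 0) (hT1l : HasSum (fun t => t l • T t) 0)
    (h2 : Summable (fun t => (t κ * t l) • T t)) (hn0 : Summable w') (hS : MonoSummable χ w T w') :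
    ∑' q, term χ w T w' (fun u t x => (t + x - u) κ * (t + x - u) l) q
      = σ * (∑' t, (t κ * t l) • T t) * (∑' x, w' x) :=
  (hasSum_term_second_of_vanishing χ w T w' hL0 hL1 hR0 κ l hT0 hT1κ hT1l h2.hasSum hn0.hasSum hS).tsum_eq

end Master

/-! ## §4 The `ConstReproSum` / `LinReproSum` forms: (L0), (L1) for patterns that are FUNCTIONS on `ℤ^d` -/

section Coset

open MomentFactorisation

variable [TopologicalSpace R]

/-- **(L0∞)** — the `tsum` version of an2's `DecimatedMoment.ConstRepro`: the translation-covariant map with the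
(possibly infinitely extended) pattern `w : ℤ^d → R` reproduces CONSTANTS through the window `N•ℤ^d` with mass `σ`:
every coset family `u ↦ cosetInd N (a − u) • w u` HAS THE SUM `σ` (unconditional summation on `ℤ^d`). [folklore] -/
def ConstReproSum (N : ℕ) (w : (Fin d → ℤ) → R) (σ : R) : Prop :=
  ∀ a, HasSum (fun u => cosetInd N (a - u) • w u) σ

/-- **(L1∞)** — the `tsum` version of `DecimatedMoment.LinRepro`: every coset first-moment family
`u ↦ (cosetInd N (a − u) · u_κ) • w u` has the sum `C κ`. [folklore] -/
def LinReproSum (N : ℕ) (w : (Fin d → ℤ) → R) (C : Fin d → R) : Prop :=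
  ∀ a κ, HasSum (fun u => (cosetInd N (a - u) * u κ) • w u) (C κ)

/-- (R0∞) for the window `cosetInd N` is `ConstReproSum` of the right pattern (the window is even). [folklore] -/
theorem constReproSum_iff_right (N : ℕ) (w' : (Fin d → ℤ) → R) (σ' : R) :
    ConstReproSum N w' σ' ↔ ∀ a, HasSum (fun x => cosetInd N (x - a) • w' x) σ' := by
  refine forall_congr' (fun a => ?_)
  rw [show (fun x => cosetInd N (x - a) • w' x) = fun x => cosetInd N (a - x) • w' x from
    funext (fun x => by rw [cosetInd_sub_comm])]

/-- CONSISTENCY: an2's `ConstRepro` (a `Finsupp` pattern) is the finitely supported case of `ConstReproSum`.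
[folklore] -/
theorem constReproSum_of_constRepro (N : ℕ) (w : LatFun d R) {σ : R} (h : ConstRepro N w σ) :
    ConstReproSum N ⇑w σ :=
  fun a => hasSum_of_support_eq w.support ⇑w (fun _ hu => Finsupp.notMem_support_iff.1 hu) _
    ((constRepro_iff N w σ).1 h a)

/-- … and `LinRepro` the finitely supported case of `LinReproSum`. [folklore] -/
theorem linReproSum_of_linRepro (N : ℕ) (w : LatFun d R) {C : Fin d → R} (h : LinRepro N w C) :
    LinReproSum N ⇑w C :=
  fun a κ => hasSum_of_support_eq w.support ⇑w (fun _ hu => Finsupp.notMem_support_iff.1 hu) _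
    ((linRepro_iff N w C).1 h a κ)

/-- Conversely (Hausdorff `R`) a `Finsupp` pattern with `ConstReproSum` has `ConstRepro`. [folklore] -/
theorem constRepro_of_constReproSum [T2Space R] (N : ℕ) (w : LatFun d R) {σ : R} (h : ConstReproSum N ⇑w σ) :
    ConstRepro N w σ :=
  (constRepro_iff N w σ).2 (fun a =>
    (hasSum_of_support_eq w.support ⇑w (fun _ hu => Finsupp.notMem_support_iff.1 hu)
      (fun u => cosetInd N (a - u)) rfl).unique (h a))

/-- … and one with `LinReproSum` has `LinRepro`. [folklore] -/
theorem linRepro_of_linReproSum [T2Space R] (N : ℕ) (w : LatFun d R) {C : Fin d → R} (h : LinReproSum N ⇑w C) :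
    LinRepro N w C :=
  (linRepro_iff N w C).2 (fun a κ =>
    (hasSum_of_support_eq w.support ⇑w (fun _ hu => Finsupp.notMem_support_iff.1 hu)
      (fun u => cosetInd N (a - u) * u κ) rfl).unique (h a κ))

variable [IsTopologicalRing R] [T2Space R]

/-- **THE `ConstReproSum` / `LinReproSum` FORM OF THE IDENTITY — patterns AND kernel infinitely extended.**
`w, T, w' : ℤ^d → R`; `w` reproduces constants (mass `σ`) and affine functions (`C`), `w'` reproduces constants
(`σ'`), through the window `N•ℤ^d`; `T` has the infinite (T0), (T1) and second moment `m₂`; `Σ w' = n₀`;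
`MonoSummable`.  Then the `N•ℤ^d`-windowed second moment of the two-sided dressed sum over ALL of
`ℤ^d × ℤ^d × ℤ^d` is `σ · m₂ · n₀`. [folklore] -/
theorem decimatedSum_second_moment_hasSum (N : ℕ) (w T w' : (Fin d → ℤ) → R) {σ σ' : R} {C : Fin d → R}
    (hw : ConstReproSum N w σ) (hw' : LinReproSum N w C) (hR : ConstReproSum N w' σ') (κ l : Fin d)
    {m₂ n₀ : R} (hT0 : HasSum T 0) (hT1κ : HasSum (fun t => t κ • T t) 0) (hT1l : HasSum (fun t => t l • T t) 0)
    (h2 : HasSum (fun t => (t κ * t l) • T t) m₂) (hn0 : HasSum w' n₀) (hS : MonoSummable (cosetInd N) w T w') :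
    HasSum (term (cosetInd N) w T w' (fun u t x => (t + x - u) κ * (t + x - u) l)) (σ * m₂ * n₀) :=
  hasSum_term_second_of_vanishing (cosetInd N) w T w' hw hw' ((constReproSum_iff_right N w' σ').1 hR) κ l
    hT0 hT1κ hT1l h2 hn0 hS

/-- `tsum` form. [folklore] -/
theorem decimatedSum_second_moment_tsum (N : ℕ) (w T w' : (Fin d → ℤ) → R) {σ σ' : R} {C : Fin d → R}
    (hw : ConstReproSum N w σ) (hw' : LinReproSum N w C) (hR : ConstReproSum N w' σ') (κ l : Fin d)
    (hT0 : HasSum T 0) (hT1κ : HasSum (fun t => t κ • T t) 0) (hT1l : HasSum (fun t => t l • T t) 0)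
    (h2 : Summable (fun t => (t κ * t l) • T t)) (hn0 : Summable w') (hS : MonoSummable (cosetInd N) w T w') :
    ∑' q, term (cosetInd N) w T w' (fun u t x => (t + x - u) κ * (t + x - u) l) q
      = σ * (∑' t, (t κ * t l) • T t) * (∑' x, w' x) :=
  (decimatedSum_second_moment_hasSum N w T w' hw hw' hR κ l hT0 hT1κ hT1l h2.hasSum hn0.hasSum hS).tsum_eq

omit [T2Space R] in
/-- CONSISTENCY WITH `Beta/DecimatedMomentLimit` (finitely supported patterns, infinitely extended kernel): for
`Finsupp` patterns the present hypotheses ARE an2's `ConstRepro` / `LinRepro` (`constReproSum_of_constRepro`,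
`linReproSum_of_linRepro`), and a sum of the triple family is a sum of the fine-point SLICE family of
`DecimatedMomentLimit` (fibres over `t`; the `(u, x)`-fibres are finite sums). [folklore] -/
theorem hasSum_slice_of_hasSum_term (χ : (Fin d → ℤ) → ℤ) (w w' : LatFun d R) (T : (Fin d → ℤ) → R)
    (g : (Fin d → ℤ) → (Fin d → ℤ) → (Fin d → ℤ) → ℤ) {a : R} (h : HasSum (term χ ⇑w T ⇑w' g) a) :
    HasSum (DecimatedMomentLimit.slice χ w.support w'.support ⇑w T ⇑w' g) a := by
  -- reindex `(u, (t, x)) ↦ (t, (u, x))`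
  let e : (Fin d → ℤ) × (Fin d → ℤ) × (Fin d → ℤ) ≃ (Fin d → ℤ) × (Fin d → ℤ) × (Fin d → ℤ) :=
    (Equiv.prodAssoc _ _ _).symm.trans (((Equiv.prodComm _ _).prodCongr (Equiv.refl _)).trans
      (Equiv.prodAssoc _ _ _))
  have he : ∀ t u x : Fin d → ℤ, e (t, u, x) = (u, t, x) := fun t u x => rfl
  have hF : HasSum (term χ ⇑w T ⇑w' g ∘ ⇑e) a := (Equiv.hasSum_iff e).mpr h
  refine hF.prod_fiberwise (fun t => ?_)
  unfold DecimatedMomentLimit.slice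
  rw [← Finset.sum_product (s := w.support) (t := w'.support)
    (f := fun p : (Fin d → ℤ) × (Fin d → ℤ) => (χ (t + p.2 - p.1) * g p.1 t p.2) • (w p.1 * T t * w' p.2))]
  refine hasSum_sum_of_ne_finset_zero (fun p hp => ?_)
  obtain ⟨u, x⟩ := p
  simp only [Finset.mem_product, not_and_or] at hp
  rw [Function.comp_apply, he, term_apply]
  rcases hp with hu | hx
  · rw [Finsupp.notMem_support_iff.1 hu, zero_mul, zero_mul, smul_zero]
  · rw [Finsupp.notMem_support_iff.1 hx, mul_zero, smul_zero]

end Coset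

/-! ## §5 Regrouping by the COARSE output point `y = t + x − u`; the decimated-lattice form -/

section Coarse

variable [TopologicalSpace R]

/-- The two-sided DRESSED KERNEL with infinitely extended patterns, as a function of the coarse output point:
`dressedSum w T w' y = Σ'_{(u,x)} w u · T (y + u − x) · w' x` (a `tsum` over `ℤ^d × ℤ^d`; cf. the finite
`DecimatedMomentLimit.dressed`). [folklore] -/
noncomputable def dressedSum (w T w' : (Fin d → ℤ) → R) (y : Fin d → ℤ) : R :=
  ∑' p : (Fin d → ℤ) × (Fin d → ℤ), w p.1 * T (y + p.1 - p.2) * w' p.2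

/-- The reindexing `(u, (t, x)) ↦ (t + x − u, (u, x))` of `ℤ^d × ℤ^d × ℤ^d` (inverse `(y, (u, x)) ↦ (u, (y + u − x, x))`).
[folklore] -/
def coarseEquiv : (Fin d → ℤ) × (Fin d → ℤ) × (Fin d → ℤ) ≃ (Fin d → ℤ) × (Fin d → ℤ) × (Fin d → ℤ) where
  toFun q := (q.2.1 + q.2.2 - q.1, q.1, q.2.2)
  invFun s := (s.2.1, s.1 + s.2.1 - s.2.2, s.2.2)
  left_inv q := by
    obtain ⟨u, t, x⟩ := q
    refine Prod.ext rfl (Prod.ext ?_ rfl)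
    show t + x - u + u - x = t
    abel
  right_inv s := by
    obtain ⟨y, u, x⟩ := s
    refine Prod.ext ?_ rfl
    show y + u - x + x - u = y
    abel

omit [TopologicalSpace R] in
/-- The triple family with a weight depending on the coarse point only, read in the coarse coordinates. [folklore] -/
theorem term_comp_coarseEquiv_symm (χ : (Fin d → ℤ) → ℤ) (w T w' : (Fin d → ℤ) → R) (φ : (Fin d → ℤ) → ℤ)
    (y u x : Fin d → ℤ) :
    (term χ w T w' (fun u t x => φ (t + x - u)) ∘ ⇑(coarseEquiv (d := d)).symm) (y, u, x)
      = (χ y * φ y) • (w u * T (y + u - x) * w' x) := by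
  show term χ w T w' (fun u t x => φ (t + x - u)) (u, y + u - x, x) = _
  rw [term_apply, show y + u - x + x - u = y by abel]

variable [IsTopologicalRing R]

/-- **REGROUPING BY THE COARSE OUTPUT POINT.**  If the triple family with weight `φ(t+x−u)` has the sum `a` and
every fibre `(u, x) ↦ w u · T (y + u − x) · w' x` of the dressed kernel is summable, then the coarse-point family
`y ↦ (χ y · φ y) • dressedSum w T w' y` — the LITERAL shape of a `χ`-windowed `φ`-moment of the dressed kernel —
has the sum `a` (`Equiv.hasSum_iff` for `coarseEquiv`, then `HasSum.prod_fiberwise`). [folklore] -/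
theorem hasSum_coarse (χ : (Fin d → ℤ) → ℤ) (w T w' : (Fin d → ℤ) → R) (φ : (Fin d → ℤ) → ℤ) {a : R}
    (h : HasSum (term χ w T w' (fun u t x => φ (t + x - u))) a)
    (hK : ∀ y, Summable (fun p : (Fin d → ℤ) × (Fin d → ℤ) => w p.1 * T (y + p.1 - p.2) * w' p.2)) :
    HasSum (fun y => (χ y * φ y) • dressedSum w T w' y) a := by
  have hF := (Equiv.hasSum_iff (coarseEquiv (d := d)).symm).mpr h
  refine hF.prod_fiberwise (fun y => ?_)
  show HasSum _ ((χ y * φ y) • ∑' p : (Fin d → ℤ) × (Fin d → ℤ), w p.1 * T (y + p.1 - p.2) * w' p.2)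
  refine ((hK y).hasSum.const_smul (χ y * φ y)).congr_fun (fun p => ?_)
  obtain ⟨u, x⟩ := p
  exact term_comp_coarseEquiv_symm χ w T w' φ y u x

variable [T2Space R]

/-- **THE IDENTITY IN THE COARSE-POINT FORM** (hypotheses of `decimatedSum_second_moment_hasSum` + fibrewise
summability of the dressed kernel): `Σ_y (cosetInd N y · y_κ y_λ) • dressedSum w T w' y = σ · m₂ · n₀`. [folklore] -/
theorem decimatedSum_second_moment_hasSum_coarse (N : ℕ) (w T w' : (Fin d → ℤ) → R) {σ σ' : R} {C : Fin d → R}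
    (hw : ConstReproSum N w σ) (hw' : LinReproSum N w C) (hR : ConstReproSum N w' σ') (κ l : Fin d)
    {m₂ n₀ : R} (hT0 : HasSum T 0) (hT1κ : HasSum (fun t => t κ • T t) 0) (hT1l : HasSum (fun t => t l • T t) 0)
    (h2 : HasSum (fun t => (t κ * t l) • T t) m₂) (hn0 : HasSum w' n₀) (hS : MonoSummable (cosetInd N) w T w')
    (hK : ∀ y, Summable (fun p : (Fin d → ℤ) × (Fin d → ℤ) => w p.1 * T (y + p.1 - p.2) * w' p.2)) :
    HasSum (fun y => (cosetInd N y * (y κ * y l)) • dressedSum w T w' y) (σ * m₂ * n₀) :=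
  hasSum_coarse (cosetInd N) w T w' (fun y => y κ * y l)
    (decimatedSum_second_moment_hasSum N w T w' hw hw' hR κ l hT0 hT1κ hT1l h2 hn0 hS) hK

/-- **… AND ON THE COARSE LATTICE** (`N ≠ 0`; decimation = reindexing, `DecimatedMomentLimit.hasSum_decimate_iff`):
the second moment of the DECIMATED dressed kernel `z ↦ dressedSum w T w' (N • z)` with the weight
`(N•z)_κ (N•z)_λ = N² · z_κ z_λ` is `σ · m₂ · n₀`. [folklore] -/
theorem decimatedSum_second_moment_hasSum_lattice {N : ℕ} (hN : N ≠ 0) (w T w' : (Fin d → ℤ) → R) {σ σ' : R}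
    {C : Fin d → R} (hw : ConstReproSum N w σ) (hw' : LinReproSum N w C) (hR : ConstReproSum N w' σ')
    (κ l : Fin d) {m₂ n₀ : R} (hT0 : HasSum T 0) (hT1κ : HasSum (fun t => t κ • T t) 0)
    (hT1l : HasSum (fun t => t l • T t) 0) (h2 : HasSum (fun t => (t κ * t l) • T t) m₂) (hn0 : HasSum w' n₀)
    (hS : MonoSummable (cosetInd N) w T w')
    (hK : ∀ y, Summable (fun p : (Fin d → ℤ) × (Fin d → ℤ) => w p.1 * T (y + p.1 - p.2) * w' p.2)) :
    HasSum (fun z : Fin d → ℤ => ((N : ℤ) ^ 2 * (z κ * z l)) • dressedSum w T w' ((N : ℤ) • z))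
      (σ * m₂ * n₀) := by
  have h := (hasSum_decimate_iff hN (fun y => y κ * y l) (dressedSum w T w') _).2
    (decimatedSum_second_moment_hasSum_coarse N w T w' hw hw' hR κ l hT0 hT1κ hT1l h2 hn0 hS hK)
  refine h.congr_fun (fun z => ?_)
  simp only [weight_zsmul]

end Coarse

/-! ## §6 Over `ℝ`: every summability hypothesis from absolutely summable second moments, hence from the
(5.10)-shape decay; the typed right member of (1.22) -/

section Real

open B12Sec2to5

/-- ABSOLUTELY SUMMABLE SECOND MOMENT: `Σ_y (1 + |y|₁²) · |f y| < ∞`. [folklore] -/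
def AbsMoment₂ (f : (Fin d → ℤ) → ℝ) : Prop :=
  Summable (fun y => (1 + l1 y ^ 2) * |f y|)

/-- Every letter of the alphabet `IsMoment₂` is bounded by `1 + |y|₁²`. [folklore] -/
theorem abs_le_of_isMoment₂ {p : (Fin d → ℤ) → ℤ} (hp : IsMoment₂ p) (y : Fin d → ℤ) :
    |(p y : ℝ)| ≤ 1 + l1 y ^ 2 := by
  cases hp with
  | one =>
    rw [Int.cast_one, abs_one]
    nlinarith [sq_nonneg (l1 y)]
  | coord μ =>
    have h := abs_coord_le_l1 y μ
    nlinarith [sq_nonneg (2 * l1 y - 1)]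
  | coord2 μ ν =>
    rw [Int.cast_mul, abs_mul]
    have hm : |(y μ : ℝ)| * |(y ν : ℝ)| ≤ l1 y * l1 y :=
      mul_le_mul (abs_coord_le_l1 y μ) (abs_coord_le_l1 y ν) (abs_nonneg _) (l1_nonneg y)
    nlinarith [hm]

/-- **ENGINE.**  Window bounded by `1` in absolute value, weight of at most quadratic growth in each variable
SEPARATELY (`|g u t x| ≤ B (1+|u|₁²)(1+|t|₁²)(1+|x|₁²)`), and `w, T, w'` with absolutely summable second moments:
the triple family is summable on `ℤ^d × ℤ^d × ℤ^d` — dominated by the product of three summable non-negative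
families (`Summable.mul_of_nonneg` twice, `Summable.of_norm_bounded`). [folklore] -/
theorem summable_term_of_bound {χ : (Fin d → ℤ) → ℤ} (hχ : ∀ z, |(χ z : ℝ)| ≤ 1) {w T w' : (Fin d → ℤ) → ℝ}
    (hw : AbsMoment₂ w) (hT : AbsMoment₂ T) (hw' : AbsMoment₂ w')
    {g : (Fin d → ℤ) → (Fin d → ℤ) → (Fin d → ℤ) → ℤ} {B : ℝ}
    (hg : ∀ u t x, |(g u t x : ℝ)| ≤ B * ((1 + l1 u ^ 2) * ((1 + l1 t ^ 2) * (1 + l1 x ^ 2)))) :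
    Summable (term χ w T w' g) := by
  have hnn : ∀ f : (Fin d → ℤ) → ℝ, 0 ≤ fun y => (1 + l1 y ^ 2) * |f y| :=
    fun f y => mul_nonneg (by positivity) (abs_nonneg _)
  have hM : Summable (fun q : (Fin d → ℤ) × (Fin d → ℤ) × (Fin d → ℤ) =>
      B * (((1 + l1 q.1 ^ 2) * |w q.1|) * (((1 + l1 q.2.1 ^ 2) * |T q.2.1|) * ((1 + l1 q.2.2 ^ 2) * |w' q.2.2|)))) :=
    (hw.mul_of_nonneg (hT.mul_of_nonneg hw' (hnn T) (hnn w')) (hnn w)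
      (fun _ => mul_nonneg (hnn T _) (hnn w' _))).mul_left B
  refine Summable.of_norm_bounded hM (fun q => ?_)
  obtain ⟨u, t, x⟩ := q
  rw [Real.norm_eq_abs, term_apply, zsmul_eq_mul, Int.cast_mul, abs_mul, abs_mul, abs_mul, abs_mul]
  have h1 : |(χ (t + x - u) : ℝ)| * |(g u t x : ℝ)| ≤ 1 * (B * ((1 + l1 u ^ 2) * ((1 + l1 t ^ 2) * (1 + l1 x ^ 2)))) :=
    mul_le_mul (hχ _) (hg u t x) (abs_nonneg _) zero_le_one
  calc |(χ (t + x - u) : ℝ)| * |(g u t x : ℝ)| * (|w u| * |T t| * |w' x|)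
      ≤ 1 * (B * ((1 + l1 u ^ 2) * ((1 + l1 t ^ 2) * (1 + l1 x ^ 2)))) * (|w u| * |T t| * |w' x|) :=
        mul_le_mul_of_nonneg_right h1 (by positivity)
    _ = B * (((1 + l1 u ^ 2) * |w u|) * (((1 + l1 t ^ 2) * |T t|) * ((1 + l1 x ^ 2) * |w' x|))) := by ring

/-- Absolutely summable second moments of `w, T, w'` ⟹ `MonoSummable` (window bounded by `1`). [folklore] -/
theorem monoSummable_of_absMoment₂ {χ : (Fin d → ℤ) → ℤ} (hχ : ∀ z, |(χ z : ℝ)| ≤ 1)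
    {w T w' : (Fin d → ℤ) → ℝ} (hw : AbsMoment₂ w) (hT : AbsMoment₂ T) (hw' : AbsMoment₂ w') :
    MonoSummable χ w T w' := by
  intro p q r hp hq hr
  refine summable_term_of_bound hχ hw hT hw' (B := 1) (fun u t x => ?_)
  rw [one_mul]
  simp only [mono, Int.cast_mul, abs_mul]
  exact mul_le_mul (abs_le_of_isMoment₂ hp u) (mul_le_mul (abs_le_of_isMoment₂ hq t)
    (abs_le_of_isMoment₂ hr x) (abs_nonneg _) (by positivity)) (by positivity) (by positivity)

/-- An absolutely summable second moment gives every windowed moment family of degree `≤ 2` (window bounded by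
`1`): `Summable (u ↦ (χ u · p u) • f u)`. [folklore] -/
theorem summable_window_smul_of_absMoment₂ {f : (Fin d → ℤ) → ℝ} (hf : AbsMoment₂ f) {χ : (Fin d → ℤ) → ℤ}
    (hχ : ∀ z, |(χ z : ℝ)| ≤ 1) {p : (Fin d → ℤ) → ℤ} (hp : IsMoment₂ p) :
    Summable (fun u => (χ u * p u) • f u) := by
  refine Summable.of_norm_bounded hf (fun u => ?_)
  rw [Real.norm_eq_abs, zsmul_eq_mul, Int.cast_mul, abs_mul, abs_mul]
  refine mul_le_mul_of_nonneg_right ?_ (abs_nonneg _)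
  calc |(χ u : ℝ)| * |(p u : ℝ)| ≤ 1 * (1 + l1 u ^ 2) :=
        mul_le_mul (hχ u) (abs_le_of_isMoment₂ hp u) (abs_nonneg _) zero_le_one
    _ = 1 + l1 u ^ 2 := one_mul _

/-- … in particular the plain moment families `p • f`. [folklore] -/
theorem summable_smul_of_absMoment₂ {f : (Fin d → ℤ) → ℝ} (hf : AbsMoment₂ f) {p : (Fin d → ℤ) → ℤ}
    (hp : IsMoment₂ p) : Summable (fun u => p u • f u) := by
  have h := summable_window_smul_of_absMoment₂ hf (χ := fun _ => 1)
    (fun _ => by rw [Int.cast_one, abs_one]) hp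
  simpa only [one_mul] using h

/-- … and `f` itself. [folklore] -/
theorem summable_of_absMoment₂ {f : (Fin d → ℤ) → ℝ} (hf : AbsMoment₂ f) : Summable f := by
  have h := summable_smul_of_absMoment₂ hf IsMoment₂.one
  simpa only [one_smul] using h

/-- Fibrewise summability of the dressed kernel: `(u, x) ↦ w u · T (y + u − x) · w' x` is summable for every `y`
(`T` is bounded by its absolute moment; `|w| ⊗ |w'|` is summable on `ℤ^d × ℤ^d`). [folklore] -/
theorem summable_dressed_fibre {w T w' : (Fin d → ℤ) → ℝ} (hw : AbsMoment₂ w) (hT : AbsMoment₂ T)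
    (hw' : AbsMoment₂ w') (y : Fin d → ℤ) :
    Summable (fun p : (Fin d → ℤ) × (Fin d → ℤ) => w p.1 * T (y + p.1 - p.2) * w' p.2) := by
  have hTb : ∀ s, |T s| ≤ ∑' t, (1 + l1 t ^ 2) * |T t| := by
    intro s
    have h1 : |T s| ≤ (1 + l1 s ^ 2) * |T s| := by
      have := abs_nonneg (T s)
      nlinarith [sq_nonneg (l1 s)]
    exact h1.trans (hT.le_tsum s (fun t _ => mul_nonneg (by positivity) (abs_nonneg _)))
  have hwa : Summable (fun u => |w u|) := (summable_of_absMoment₂ hw).abs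
  have hw'a : Summable (fun x => |w' x|) := (summable_of_absMoment₂ hw').abs
  have hM : Summable (fun p : (Fin d → ℤ) × (Fin d → ℤ) =>
      (|w p.1| * ∑' t, (1 + l1 t ^ 2) * |T t|) * |w' p.2|) :=
    (hwa.mul_right _).mul_of_nonneg hw'a (fun u => mul_nonneg (abs_nonneg _)
      ((abs_nonneg _).trans (hTb 0))) (fun x => abs_nonneg _)
  refine Summable.of_norm_bounded hM (fun p => ?_)
  rw [Real.norm_eq_abs, abs_mul, abs_mul]
  exact mul_le_mul_of_nonneg_right (mul_le_mul_of_nonneg_left (hTb _) (abs_nonneg _)) (abs_nonneg _)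

/-- (5.10)-shape decay (`Decay510 f C δ₁`, `δ₁ > 0`) ⟹ absolutely summable second moment (by the engine of
`Beta/DecimatedMomentLimit`, `summable_weight_mul_of_decay510`). [folklore] -/
theorem absMoment₂_of_decay510 {f : (Fin d → ℤ) → ℝ} {C δ₁ : ℝ} (hδ : 0 < δ₁) (h : Decay510 f C δ₁) :
    AbsMoment₂ f := by
  have h' : Decay510 (fun t => |f t|) C δ₁ := fun t => by rw [abs_abs]; exact h t
  exact summable_weight_mul_of_decay510 hδ h' (a := fun t => 1 + l1 t ^ 2) (B := 1)
    (fun t => by rw [one_mul, abs_of_nonneg (by positivity)])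

/-- A `tsum` identity for a windowed moment family of degree `≤ 2` of a pattern with absolutely summable second
moment IS the corresponding `HasSum` statement. [folklore] -/
theorem hasSum_window_of_tsum_eq {f : (Fin d → ℤ) → ℝ} (hf : AbsMoment₂ f) {χ : (Fin d → ℤ) → ℤ}
    (hχ : ∀ z, |(χ z : ℝ)| ≤ 1) {p : (Fin d → ℤ) → ℤ} (hp : IsMoment₂ p) {c : ℝ}
    (h : ∑' u, (χ u * p u) • f u = c) : HasSum (fun u => (χ u * p u) • f u) c := by
  rw [← h]
  exact (summable_window_smul_of_absMoment₂ hf hχ hp).hasSum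

/-- `ConstReproSum` from the `tsum` identities `Σ' cosetInd N (a − u) · w u = σ` (absolutely summable `w`). [folklore] -/
theorem constReproSum_of_tsum (N : ℕ) {w : (Fin d → ℤ) → ℝ} (hw : AbsMoment₂ w) {σ : ℝ}
    (h : ∀ a, ∑' u, (cosetInd N (a - u) : ℝ) * w u = σ) : ConstReproSum N w σ := by
  intro a
  have hs : Summable (fun u => cosetInd N (a - u) • w u) := by
    have := summable_window_smul_of_absMoment₂ hw (χ := fun u => cosetInd N (a - u))
      (fun u => abs_cosetInd_le_one N (a - u)) IsMoment₂.one
    simpa only [mul_one] using this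
  have e : (fun u => cosetInd N (a - u) • w u) = fun u => (cosetInd N (a - u) : ℝ) * w u :=
    funext (fun u => zsmul_eq_mul _ _)
  have h' := hs.hasSum
  rw [e] at h' ⊢
  rwa [h a] at h'

/-- `LinReproSum` from the `tsum` identities `Σ' cosetInd N (a − u) · u_κ · w u = C κ`. [folklore] -/
theorem linReproSum_of_tsum (N : ℕ) {w : (Fin d → ℤ) → ℝ} (hw : AbsMoment₂ w) {C : Fin d → ℝ}
    (h : ∀ a κ, ∑' u, (cosetInd N (a - u) : ℝ) * (u κ : ℝ) * w u = C κ) : LinReproSum N w C := by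
  intro a κ
  have hs : Summable (fun u => (cosetInd N (a - u) * u κ) • w u) :=
    summable_window_smul_of_absMoment₂ hw (χ := fun u => cosetInd N (a - u))
      (fun u => abs_cosetInd_le_one N (a - u)) (IsMoment₂.coord κ)
  have e : (fun u => (cosetInd N (a - u) * u κ) • w u) = fun u => (cosetInd N (a - u) : ℝ) * (u κ : ℝ) * w u :=
    funext (fun u => by rw [zsmul_eq_mul, Int.cast_mul])
  have h' := hs.hasSum
  rw [e] at h' ⊢
  rwa [h a κ] at h'

/-- **ABSOLUTELY SUMMABLE SECOND MOMENTS ⟹ THE IDENTITY, in the fine-point, the coarse-point and the coarse-lattice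
form, every summability discharged.**  `w, T, w' : ℤ^d → ℝ` with `AbsMoment₂`; `w` reproduces constants (`σ`) and
affine functions (`C'`) through `N•ℤ^d`, `w'` reproduces constants (`σ'`) — as `tsum` identities; `T` has the
infinite (T0), (T1) `Σ' T = 0`, `Σ' t_κ T = Σ' t_λ T = 0`.  Then, with `m₂ = Σ'_t T t · t_κ · t_λ` (integrand order of
`B12Beta.secondMoment`) and `n₀ = Σ' w'`: the `N•ℤ^d`-windowed second moment of the two-sided dressed sum over all
of `ℤ^d × ℤ^d × ℤ^d` is `σ · m₂ · n₀`, and so is `Σ_y (cosetInd N y · y_κ y_λ) • dressedSum w T w' y`. [folklore] -/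
theorem decimatedSum_second_moment_of_absMoment₂ (N : ℕ) (w T w' : (Fin d → ℤ) → ℝ) (hw : AbsMoment₂ w)
    (hT : AbsMoment₂ T) (hw' : AbsMoment₂ w') {σ σ' : ℝ} {C' : Fin d → ℝ}
    (hL0 : ∀ a, ∑' u, (cosetInd N (a - u) : ℝ) * w u = σ)
    (hL1 : ∀ a κ, ∑' u, (cosetInd N (a - u) : ℝ) * (u κ : ℝ) * w u = C' κ)
    (hR0 : ∀ a, ∑' x, (cosetInd N (a - x) : ℝ) * w' x = σ') (κ l : Fin d)
    (hT0 : ∑' t, T t = 0) (hT1κ : ∑' t, (t κ : ℝ) * T t = 0) (hT1l : ∑' t, (t l : ℝ) * T t = 0) :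
    HasSum (term (cosetInd N) w T w' (fun u t x => (t + x - u) κ * (t + x - u) l))
        (σ * (∑' t, T t * (t κ : ℝ) * (t l : ℝ)) * ∑' x, w' x)
      ∧ HasSum (fun y => (cosetInd N y * (y κ * y l)) • dressedSum w T w' y)
        (σ * (∑' t, T t * (t κ : ℝ) * (t l : ℝ)) * ∑' x, w' x) := by
  -- the `HasSum` hypotheses of §4/§5 from absolute summability + the `tsum` identities
  have h0 : HasSum T 0 := by
    have := (summable_of_absMoment₂ hT).hasSum
    rwa [hT0] at this
  have e1 : ∀ μ : Fin d, (fun t : Fin d → ℤ => t μ • T t) = fun t => (t μ : ℝ) * T t :=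
    fun μ => funext (fun t => zsmul_eq_mul _ _)
  have h1 : ∀ μ : Fin d, ∑' t, (t μ : ℝ) * T t = 0 → HasSum (fun t : Fin d → ℤ => t μ • T t) 0 := by
    intro μ hμ
    have := (summable_smul_of_absMoment₂ hT (IsMoment₂.coord μ)).hasSum
    rw [e1 μ] at this ⊢
    rwa [hμ] at this
  have e2 : (fun t : Fin d → ℤ => (t κ * t l) • T t) = fun t => (t κ : ℝ) * (t l : ℝ) * T t :=
    funext (fun t => by rw [zsmul_eq_mul, Int.cast_mul])
  have h2 : HasSum (fun t : Fin d → ℤ => (t κ * t l) • T t) (∑' t, T t * (t κ : ℝ) * (t l : ℝ)) := by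
    rw [e2, tsum_congr (fun t => show T t * (t κ : ℝ) * (t l : ℝ) = (t κ : ℝ) * (t l : ℝ) * T t by ring)]
    have := (summable_smul_of_absMoment₂ hT (IsMoment₂.coord2 κ l)).hasSum
    rwa [e2] at this
  have A := decimatedSum_second_moment_hasSum N w T w' (constReproSum_of_tsum N hw hL0)
    (linReproSum_of_tsum N hw hL1) (constReproSum_of_tsum N hw' hR0) κ l h0 (h1 κ hT1κ) (h1 l hT1l) h2
    (summable_of_absMoment₂ hw').hasSum
    (monoSummable_of_absMoment₂ (fun z => abs_cosetInd_le_one N z) hw hT hw')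
  exact ⟨A, hasSum_coarse (cosetInd N) w T w' (fun y => y κ * y l) A (summable_dressed_fibre hw hT hw')⟩

/-- **COARSE-LATTICE FORM** over `ℝ` (`N ≠ 0`): the second moment of the decimated dressed kernel
`z ↦ dressedSum w T w' (N • z)`, weight `N² · z_κ z_λ`, is `σ · m₂ · n₀`. [folklore] -/
theorem decimatedSum_second_moment_of_absMoment₂_lattice {N : ℕ} (hN : N ≠ 0) (w T w' : (Fin d → ℤ) → ℝ)
    (hw : AbsMoment₂ w) (hT : AbsMoment₂ T) (hw' : AbsMoment₂ w') {σ σ' : ℝ} {C' : Fin d → ℝ}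
    (hL0 : ∀ a, ∑' u, (cosetInd N (a - u) : ℝ) * w u = σ)
    (hL1 : ∀ a κ, ∑' u, (cosetInd N (a - u) : ℝ) * (u κ : ℝ) * w u = C' κ)
    (hR0 : ∀ a, ∑' x, (cosetInd N (a - x) : ℝ) * w' x = σ') (κ l : Fin d)
    (hT0 : ∑' t, T t = 0) (hT1κ : ∑' t, (t κ : ℝ) * T t = 0) (hT1l : ∑' t, (t l : ℝ) * T t = 0) :
    HasSum (fun z : Fin d → ℤ => ((N : ℤ) ^ 2 * (z κ * z l)) • dressedSum w T w' ((N : ℤ) • z))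
      (σ * (∑' t, T t * (t κ : ℝ) * (t l : ℝ)) * ∑' x, w' x) := by
  have h := (hasSum_decimate_iff hN (fun y => y κ * y l) (dressedSum w T w') _).2
    (decimatedSum_second_moment_of_absMoment₂ N w T w' hw hT hw' hL0 hL1 hR0 κ l hT0 hT1κ hT1l).2
  refine h.congr_fun (fun z => ?_)
  simp only [weight_zsmul]

/-- **(5.10)-SHAPE DECAY OF ALL THREE FACTORS ⟹ THE IDENTITY** (each factor with its own constants; the typed decay
shape of the B12 §2–5 module, `B12Sec2to5.Decay510`). [folklore] -/
theorem decimatedSum_second_moment_of_decay510 (N : ℕ) (w T w' : (Fin d → ℤ) → ℝ) {Cw CT Cx δw δT δx : ℝ}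
    (hδw : 0 < δw) (hdw : Decay510 w Cw δw) (hδT : 0 < δT) (hdT : Decay510 T CT δT) (hδx : 0 < δx)
    (hdx : Decay510 w' Cx δx) {σ σ' : ℝ} {C' : Fin d → ℝ}
    (hL0 : ∀ a, ∑' u, (cosetInd N (a - u) : ℝ) * w u = σ)
    (hL1 : ∀ a κ, ∑' u, (cosetInd N (a - u) : ℝ) * (u κ : ℝ) * w u = C' κ)
    (hR0 : ∀ a, ∑' x, (cosetInd N (a - x) : ℝ) * w' x = σ') (κ l : Fin d)
    (hT0 : ∑' t, T t = 0) (hT1κ : ∑' t, (t κ : ℝ) * T t = 0) (hT1l : ∑' t, (t l : ℝ) * T t = 0) :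
    HasSum (term (cosetInd N) w T w' (fun u t x => (t + x - u) κ * (t + x - u) l))
        (σ * (∑' t, T t * (t κ : ℝ) * (t l : ℝ)) * ∑' x, w' x)
      ∧ HasSum (fun y => (cosetInd N y * (y κ * y l)) • dressedSum w T w' y)
        (σ * (∑' t, T t * (t κ : ℝ) * (t l : ℝ)) * ∑' x, w' x) :=
  decimatedSum_second_moment_of_absMoment₂ N w T w' (absMoment₂_of_decay510 hδw hdw) (absMoment₂_of_decay510 hδT hdT)
    (absMoment₂_of_decay510 hδx hdx) hL0 hL1 hR0 κ l hT0 hT1κ hT1l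

/-- **THE TYPED RIGHT MEMBER OF (1.22)**, all three factors infinitely extended: for a component kernel `T = P μ ν`
of a `B12Beta.Kernel` with absolutely summable second moment and the infinite (T0), (T1), and patterns `w, w'` with
absolutely summable second moments reproducing constants / affine functions through `N•ℤ^d` (as `tsum` identities):
`Σ'_y (cosetInd N y · y_μ y_ν) • dressedSum w (P μ ν) w' y = σ · B12Beta.secondMoment P μ ν · Σ' w'`.
(Consistency of the cell's decimated/dressed reading of Π with the printed number at the level of the limit
objects; nothing of Bałaban's is asserted.) [folklore] -/
theorem decimatedSum_second_moment_eq_secondMoment (N : ℕ) (w w' : (Fin d → ℤ) → ℝ) (P : B12Beta.Kernel d)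
    (μ ν : Fin d) (hw : AbsMoment₂ w) (hT : AbsMoment₂ (P μ ν)) (hw' : AbsMoment₂ w') {σ σ' : ℝ} {C' : Fin d → ℝ}
    (hL0 : ∀ a, ∑' u, (cosetInd N (a - u) : ℝ) * w u = σ)
    (hL1 : ∀ a κ, ∑' u, (cosetInd N (a - u) : ℝ) * (u κ : ℝ) * w u = C' κ)
    (hR0 : ∀ a, ∑' x, (cosetInd N (a - x) : ℝ) * w' x = σ') (hT0 : ∑' t, P μ ν t = 0)
    (hT1μ : ∑' t, (t μ : ℝ) * P μ ν t = 0) (hT1ν : ∑' t, (t ν : ℝ) * P μ ν t = 0) :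
    ∑' y, (cosetInd N y * (y μ * y ν)) • dressedSum w (P μ ν) w' y
      = σ * B12Beta.secondMoment P μ ν * ∑' x, w' x :=
  (decimatedSum_second_moment_of_absMoment₂ N w (P μ ν) w' hw hT hw' hL0 hL1 hR0 μ ν hT0 hT1μ hT1ν).2.tsum_eq

/-- CONSISTENCY WITH THE FINITELY SUPPORTED SETTING: a finitely supported real pattern has an absolutely summable
second moment, so §6 contains §4 of `Beta/DecimatedMomentLimit` for `Finsupp` patterns `w, w'` (the hypotheses
there being the present ones by `constReproSum_of_constRepro` / `linReproSum_of_linRepro`). [folklore] -/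
theorem absMoment₂_of_finsupp (w : MomentFactorisation.LatFun d ℝ) : AbsMoment₂ ⇑w := by
  refine summable_of_ne_finset_zero (s := w.support) (fun u hu => ?_)
  rw [Finsupp.notMem_support_iff.1 hu, abs_zero, mul_zero]

end Real

end Literature.MathematicalPhysics.QuantumFieldTheory.Balaban1983to89.Beta.DecimatedMomentSummable
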